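import Mathlib
import HarnessLib
import Literature.Analysis.FluidPDE.VectorCalculus
import Literature.Analysis.FluidPDE.VorticityCalculus
import Summits.NavierStokesRegularity.NavierStokesRegularity.Theorems.UnthreadedRigidityDoorUnthreadedRigidityCoZonalSameDegree
import Summits.NavierStokesRegularity.NavierStokesRegularity.Theorems.UnthreadedRigidityDoorUnthreadedRigidityThreadingJetsWindowGeneric

/-!
# W2 door `UnthreadedRigidity` (stmt-NavierStokesRegularity-27585) — LINE g12-1 «CO-ZONAL»: ★★ THE DIAGONAL `TwoShellWindowRigidity l l`, every degree

Prover file (engine-1 g72; `--supports stmt-NavierStokesRegularity-27585 --as helper`; route-independent imports).  The CO-ZONAL line (planner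
ns-idea-6 g12, `…CoZonalDefs`) states its window rung `TwoShellWindowRigidity l₁ l₂` for all degree pairs and books it only OFF the diagonal
(`TwoShellWindowRigidityAll`: `l₁ ≠ l₂`, where the residual R «linked pairs» remains).  ON THE DIAGONAL the rung holds UNCONDITIONALLY:

★★ `twoShellWindowRigidity_sameDegree (l) (hl : 1 ≤ l) : TwoShellWindowRigidity l l` — an unthreaded window (hypotheses of 27585 verbatim) all of whose
slices are two-shells `curl curl (H₁(t,|y|)Y₁ y) + curl curl (H₂(t,|y|)Y₂ y)` over two FIXED nonzero solid harmonics of the SAME degree `l ≥ 1` is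
axisymmetric about one common axis through `x₀`.  If `Y₁, Y₂` are linearly independent the slices are `l`-isotypic data over the pair
(`twoShellL_eq_isoShellL_two`) and `isotypicWindowRigidityL_two_harmonics` (same-degree non-commutation, file `…CoZonalSameDegree`) applies; if
`Y₂ = cY₁` the slices are separable shells with profile `H₁ + cH₂` (`twoShellL_eq_sepShellL_of_smul`, `virialAdmissible_add_mul`) and
`separableWindowRigidityL` applies.  Tool: `curl_curl_add` (two curls of a sum of smooth potentials).

HONEST LABEL: two-shell windows are SPECIAL data (a restriction of 27585); off the diagonal the residual R (linked pairs) stays OPEN;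
`UnthreadedRigidity` (27585), W2 and NS regularity remain OPEN; nothing here is a statement about Navier–Stokes regularity.  0 kit.
-/

noncomputable section

-- the summit and its single sub-problem share the name (CONVENTIONS §1), as in every Theorems file
set_option linter.dupNamespace false

namespace Summit.NavierStokesRegularity.NavierStokesRegularity.Theorems.UnthreadedRigidity.CoZonal

open scoped Topology InnerProductSpace ContDiff
open Filter Set
open Literature.Analysis.FluidPDE
open Summit.NavierStokesRegularity.NavierStokesRegularity.Theorems.UnthreadedRigidity.VirialHorn
open Summit.NavierStokesRegularity.NavierStokesRegularity.Theorems.UnthreadedRigidity.ProfileHorn (E3)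
open Summit.NavierStokesRegularity.NavierStokesRegularity.Theorems.UnthreadedRigidity.ThreadingJets (separableWindowRigidityL
  virialAdmissible_hasDerivAt_of_pos)

/-! ## §1 Two curls of a sum; admissible profiles form a subspace -/

/-- two curls of a sum of smooth fields. -/
theorem curl_curl_add {F G : E3 → E3} (hF : ContDiff ℝ (⊤ : ℕ∞) F) (hG : ContDiff ℝ (⊤ : ℕ∞) G) :
    curl (curl (fun z => F z + G z)) = fun z => curl (curl F) z + curl (curl G) z := by
  have hFd : Differentiable ℝ F := hF.differentiable (by simp)
  have hGd : Differentiable ℝ G := hG.differentiable (by simp)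
  have hcF : ContDiff ℝ (⊤ : ℕ∞) (curl F) := contDiff_curl (n := ⊤) (by simpa using hF)
  have hcG : ContDiff ℝ (⊤ : ℕ∞) (curl G) := contDiff_curl (n := ⊤) (by simpa using hG)
  have hcFd : Differentiable ℝ (curl F) := hcF.differentiable (by simp)
  have hcGd : Differentiable ℝ (curl G) := hcG.differentiable (by simp)
  have h1 : curl (fun z => F z + G z) = fun z => curl F z + curl G z := by
    funext z
    rw [curl_eq_curlCLM, curl_eq_curlCLM F, curl_eq_curlCLM G, fderiv_fun_add (hFd z) (hGd z), map_add]
  rw [h1]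
  funext z
  rw [curl_eq_curlCLM, curl_eq_curlCLM (curl F), curl_eq_curlCLM (curl G), fderiv_fun_add (hcFd z) (hcGd z), map_add]

/-- the translated shell potential `x ↦ (h(|x − x₀|²) Y(x − x₀)) (x − x₀)` is smooth. -/
theorem contDiff_shellPotential_sub {h : ℝ → ℝ} (hh : ContDiff ℝ (⊤ : ℕ∞) h) {l : ℕ} {Y : E3 → ℝ} (hY : IsSolidHarmonic l Y) (x₀ : E3) :
    ContDiff ℝ (⊤ : ℕ∞) (fun x : E3 => (h (‖x - x₀‖ ^ 2) * Y (x - x₀)) • (x - x₀)) :=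
  (contDiff_shell hh hY).comp (contDiff_id.sub contDiff_const)

/-- ★ virial-admissible profiles of one degree form a subspace: `H₁ + c H₂` is admissible. -/
theorem virialAdmissible_add_mul {l : ℕ} {H₁ H₂ : ℝ → ℝ} (h₁ : VirialAdmissible l H₁) (h₂ : VirialAdmissible l H₂) (c : ℝ) :
    VirialAdmissible l (fun r => H₁ r + c * H₂ r) := by
  obtain ⟨g₁, hg₁, hH₁, hd₁⟩ := virialAdmissible_hasDerivAt_of_pos h₁
  obtain ⟨g₂, hg₂, hH₂, hd₂⟩ := virialAdmissible_hasDerivAt_of_pos h₂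
  obtain ⟨C₁, hC₁⟩ := h₁.2
  obtain ⟨C₂, hC₂⟩ := h₂.2
  refine ⟨⟨fun s => g₁ s + c * g₂ s, hg₁.add (contDiff_const.mul hg₂), fun r hr => by simp only [hH₁ r hr, hH₂ r hr]⟩,
    C₁ + |c| * C₂, fun r hr => ?_⟩
  have hr0 : 0 < r := by linarith
  obtain ⟨a₁, b₁, c₁⟩ := hC₁ r hr
  obtain ⟨a₂, b₂, c₂⟩ := hC₂ r hr
  -- first and second derivatives of the sum on `(0,∞)`
  have hD1' : ∀ s, 0 < s → HasDerivAt (fun r => H₁ r + c * H₂ r) (deriv H₁ s + c * deriv H₂ s) s := fun s hs => by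
    have h := (hd₁ s hs).add ((hd₂ s hs).const_mul c)
    rw [(hd₁ s hs).deriv, (hd₂ s hs).deriv]
    exact h
  have hD1 : ∀ s, 0 < s → deriv (fun r => H₁ r + c * H₂ r) s = deriv H₁ s + c * deriv H₂ s := fun s hs => (hD1' s hs).deriv
  have hev : deriv (fun r => H₁ r + c * H₂ r) =ᶠ[𝓝 r] fun s => deriv H₁ s + c * deriv H₂ s := by
    filter_upwards [Ioi_mem_nhds hr0] with s hs using hD1 s hs
  -- `deriv Hᵢ` is differentiable at `r > 0` (it is `s ↦ 2 s gᵢ′(s²)` near `r`)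
  have hdd : ∀ {H g : ℝ → ℝ}, ContDiff ℝ (⊤ : ℕ∞) g → (∀ s, 0 < s → HasDerivAt H (2 * s * deriv g (s ^ 2)) s) →
      DifferentiableAt ℝ (deriv H) r := by
    intro H g hg hd
    have hev' : deriv H =ᶠ[𝓝 r] fun s => 2 * s * deriv g (s ^ 2) := by
      filter_upwards [Ioi_mem_nhds hr0] with s hs using (hd s hs).deriv
    have hg' : ContDiff ℝ (⊤ : ℕ∞) (deriv g) := hg.deriv'
    have hsm : Differentiable ℝ (fun s : ℝ => 2 * s * deriv g (s ^ 2)) :=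
      ((differentiable_const _).mul differentiable_id).mul ((hg'.differentiable (by simp)).comp (differentiable_id.pow 2))
    exact (hsm r).congr_of_eventuallyEq hev'
  have hD2 : deriv (deriv (fun r => H₁ r + c * H₂ r)) r = deriv (deriv H₁) r + c * deriv (deriv H₂) r := by
    rw [hev.deriv_eq]
    have e1 := hdd hg₁ hd₁
    have e2 := hdd hg₂ hd₂
    have h : HasDerivAt (fun s => deriv H₁ s + c * deriv H₂ s) (deriv (deriv H₁) r + c * deriv (deriv H₂) r) r :=
      e1.hasDerivAt.add (e2.hasDerivAt.const_mul c)
    exact h.deriv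
  have hrp : ∀ k : ℕ, 0 ≤ r ^ k := fun k => pow_nonneg hr0.le k
  -- the generic estimate `r^k |A + cB| ≤ C₁ + |c| C₂`
  have est : ∀ (k : ℕ) (A B : ℝ), r ^ k * |A| ≤ C₁ → r ^ k * |B| ≤ C₂ → r ^ k * |A + c * B| ≤ C₁ + |c| * C₂ := by
    intro k A B hA hB
    have hab : |A + c * B| ≤ |A| + |c| * |B| := by
      calc |A + c * B| ≤ |A| + |c * B| := abs_add_le _ _
        _ = |A| + |c| * |B| := by rw [abs_mul]
    calc r ^ k * |A + c * B| ≤ r ^ k * (|A| + |c| * |B|) := mul_le_mul_of_nonneg_left hab (hrp k)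
      _ = r ^ k * |A| + |c| * (r ^ k * |B|) := by ring
      _ ≤ C₁ + |c| * C₂ := add_le_add hA (mul_le_mul_of_nonneg_left hB (abs_nonneg c))
  refine ⟨est _ _ _ a₁ a₂, ?_, ?_⟩
  · rw [hD1 r hr0]; exact est _ _ _ b₁ b₂
  · rw [hD2]; exact est _ _ _ c₁ c₂

/-! ## §2 The two-shell as an isotypic pair, or as one separable shell -/

section Shapes

variable {l : ℕ} {H₁ H₂ : ℝ → ℝ} {Y₁ Y₂ : E3 → ℝ}

/-- THE TWO-SHELL IS THE ISOTYPIC DATUM OVER THE PAIR `(Y₁, Y₂)` with coefficients `(H₁, H₂)`. -/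
theorem twoShellL_eq_isoShellL_two (hH₁ : VirialAdmissible l H₁) (hH₂ : VirialAdmissible l H₂) (hY₁ : IsSolidHarmonic l Y₁)
    (hY₂ : IsSolidHarmonic l Y₂) (x₀ : E3) : twoShellL H₁ H₂ Y₁ Y₂ x₀ = isoShellL 2 ![H₁, H₂] ![Y₁, Y₂] x₀ := by
  obtain ⟨g₁, hg₁, hHg₁⟩ := hH₁.1
  obtain ⟨g₂, hg₂, hHg₂⟩ := hH₂.1
  have e₁ : (fun x : E3 => (H₁ ‖x - x₀‖ * Y₁ (x - x₀)) • (x - x₀)) = fun x => (g₁ (‖x - x₀‖ ^ 2) * Y₁ (x - x₀)) • (x - x₀) := by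
    funext x; rw [hHg₁ _ (norm_nonneg _)]
  have e₂ : (fun x : E3 => (H₂ ‖x - x₀‖ * Y₂ (x - x₀)) • (x - x₀)) = fun x => (g₂ (‖x - x₀‖ ^ 2) * Y₂ (x - x₀)) • (x - x₀) := by
    funext x; rw [hHg₂ _ (norm_nonneg _)]
  have eI : (fun x : E3 => (∑ m : Fin 2, (![H₁, H₂] : Fin 2 → ℝ → ℝ) m ‖x - x₀‖ * (![Y₁, Y₂] : Fin 2 → E3 → ℝ) m (x - x₀)) • (x - x₀))
      = fun x => (g₁ (‖x - x₀‖ ^ 2) * Y₁ (x - x₀)) • (x - x₀) + (g₂ (‖x - x₀‖ ^ 2) * Y₂ (x - x₀)) • (x - x₀) := by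
    funext x
    simp only [Fin.sum_univ_two, Matrix.cons_val_zero, Matrix.cons_val_one]
    rw [hHg₁ _ (norm_nonneg _), hHg₂ _ (norm_nonneg _), add_smul]
  unfold twoShellL isoShellL sepShellL
  rw [e₁, e₂, eI, curl_curl_add (contDiff_shellPotential_sub hg₁ hY₁ x₀) (contDiff_shellPotential_sub hg₂ hY₂ x₀)]

/-- A DEPENDENT TWO-SHELL IS ONE SEPARABLE SHELL: if `Y₂ = cY₁` then the two-shell is the shell of `Y₁` with profile `H₁ + cH₂`. -/
theorem twoShellL_eq_sepShellL_of_smul (hH₁ : VirialAdmissible l H₁) (hH₂ : VirialAdmissible l H₂) (hY₁ : IsSolidHarmonic l Y₁)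
    (x₀ : E3) {c : ℝ} (hc : ∀ y, Y₂ y = c * Y₁ y) :
    twoShellL H₁ H₂ Y₁ Y₂ x₀ = sepShellL (fun r => H₁ r + c * H₂ r) Y₁ x₀ := by
  obtain ⟨g₁, hg₁, hHg₁⟩ := hH₁.1
  obtain ⟨g₂, hg₂, hHg₂⟩ := hH₂.1
  have e₁ : (fun x : E3 => (H₁ ‖x - x₀‖ * Y₁ (x - x₀)) • (x - x₀)) = fun x => (g₁ (‖x - x₀‖ ^ 2) * Y₁ (x - x₀)) • (x - x₀) := by
    funext x; rw [hHg₁ _ (norm_nonneg _)]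
  have e₂ : (fun x : E3 => (H₂ ‖x - x₀‖ * Y₂ (x - x₀)) • (x - x₀)) = fun x => ((c * g₂ (‖x - x₀‖ ^ 2)) * Y₁ (x - x₀)) • (x - x₀) := by
    funext x; rw [hHg₂ _ (norm_nonneg _), hc]; ring_nf
  have eS : (fun x : E3 => ((H₁ ‖x - x₀‖ + c * H₂ ‖x - x₀‖) * Y₁ (x - x₀)) • (x - x₀))
      = fun x => (g₁ (‖x - x₀‖ ^ 2) * Y₁ (x - x₀)) • (x - x₀) + ((c * g₂ (‖x - x₀‖ ^ 2)) * Y₁ (x - x₀)) • (x - x₀) := by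
    funext x
    rw [hHg₁ _ (norm_nonneg _), hHg₂ _ (norm_nonneg _), ← add_smul]; ring_nf
  have hg₂' : ContDiff ℝ (⊤ : ℕ∞) (fun s => c * g₂ s) := contDiff_const.mul hg₂
  unfold twoShellL sepShellL
  rw [e₁, e₂, eS, curl_curl_add (contDiff_shellPotential_sub hg₁ hY₁ x₀) (contDiff_shellPotential_sub hg₂' hY₁ x₀)]

end Shapes

/-! ## §3 ★★ The diagonal of the CO-ZONAL window rung -/

/-- ★★ **TWO-SHELL WINDOWS OF EQUAL DEGREE ARE RIGID** (`TwoShellWindowRigidity l l`, every `l ≥ 1`, unconditionally): independent harmonics ⇒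
an `l`-isotypic pair window (`isotypicWindowRigidityL_two_harmonics`); dependent harmonics ⇒ a separable window (`separableWindowRigidityL`). -/
theorem twoShellWindowRigidity_sameDegree (l : ℕ) (hl : 1 ≤ l) : TwoShellWindowRigidity l l := by
  intro S hS hconn u x₀ hcont hdiv hmild hbdd hunth Y₁ Y₂ H₁f H₂f hY₁ hY₂ hne₁ _hne₂ hH₁ hH₂ hu
  by_cases hli : LinearIndependent ℝ (![Y₁, Y₂] : Fin 2 → E3 → ℝ)
  · -- an isotypic pair window
    refine isotypicWindowRigidityL_two_harmonics l hl S hS hconn u x₀ hcont hdiv hmild hbdd hunth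
      ⟨![Y₁, Y₂], fun t => ![H₁f t, H₂f t], hli, fun t ht => ⟨⟨fun m => ?_, fun m => ?_⟩, ?_⟩⟩
    · fin_cases m
      · simpa using hY₁
      · simpa using hY₂
    · fin_cases m
      · simpa using hH₁ t ht
      · simpa using hH₂ t ht
    · rw [hu t ht]
      exact twoShellL_eq_isoShellL_two (hH₁ t ht) (hH₂ t ht) hY₁ hY₂ x₀
  · -- a dependent pair: `Y₂ = cY₁`, a separable window
    have hdep : ∃ s t : ℝ, s • Y₁ + t • Y₂ = 0 ∧ ¬(s = 0 ∧ t = 0) := by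
      by_contra h
      push Not at h
      exact hli (LinearIndependent.pair_iff.2 h)
    obtain ⟨s, t, hst, hst0⟩ := hdep
    have ht0 : t ≠ 0 := by
      intro ht
      apply hst0
      refine ⟨?_, ht⟩
      rw [ht, zero_smul, add_zero] at hst
      by_contra hs
      obtain ⟨y, hy⟩ := hne₁
      have := congrFun hst y
      simp only [Pi.smul_apply, smul_eq_mul, Pi.zero_apply] at this
      exact hy ((mul_eq_zero.1 this).resolve_left hs)
    have hc : ∀ y, Y₂ y = (-s / t) * Y₁ y := fun y => by
      have := congrFun hst y
      simp only [Pi.add_apply, Pi.smul_apply, smul_eq_mul, Pi.zero_apply] at this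
      field_simp
      linarith
    refine separableWindowRigidityL hl hS hconn hcont hdiv hmild hbdd hunth fun τ hτ =>
      ⟨fun r => H₁f τ r + (-s / t) * H₂f τ r, Y₁, virialAdmissible_add_mul (hH₁ τ hτ) (hH₂ τ hτ) _, hY₁, ?_⟩
    rw [hu τ hτ]
    exact twoShellL_eq_sepShellL_of_smul (hH₁ τ hτ) (hH₂ τ hτ) hY₁ x₀ hc

end Summit.NavierStokesRegularity.NavierStokesRegularity.Theorems.UnthreadedRigidity.CoZonal

end
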